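import Mathlib
import Summits.AtomisticToContinuum.Crystallization.Theses.PhononSlackCertificates
import Literature.MathematicalPhysics.StatisticalMechanics.BarlowCoordination
import Literature.MathematicalPhysics.StatisticalMechanics.HcpHomogeneous
import Literature.Geometry.DiscreteGeometry.LayerShellPatterns
import Literature.Geometry.DiscreteGeometry.TwoShellPatterns

/-!
# Crux `PhononSlackCertificates.NearFarGlueR` (stmt-AtomisticToContinuum-14970), line `Sketch`:
two-shell geometry of the hexagonal close packing — a bad hcp particle owns a vacant site

Continuation lead c2; part 1 of 2 of the HCP LATTICE-SUBSET COERCIVITY theorem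
(`PhononSlackCertificatesNearFarGlueRHcpSubset.lean`), the hcp twin of the fcc statement of
`PhononSlackCertificatesNearFarGlueRLatticeShell.lean` / `…LatticeSubset.lean` (lead c1).  The hcp
point set is NOT a lattice; what replaces translation invariance is vertex-transitivity
(`hcpStacking_homogeneous`: the stacking seen from any of its points is the stacking seen from the
origin, up to the identity or the half-turn).  For the ideal stacking `hcpStacking a h`,
`h² = ⅔a²`:

* `exists_site_of_mem_hcpTwoShellInt` / `smul_closePackingFrame_eq_barlowPos` — the eighteen
  points `a • A₁ v`, `v ∈ hcpTwoShellPattern` (the tree's pattern, `A₁ = closePackingFrame 1` the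
  close-packing frame of `LayerShellPatterns.lean`), are stacking points: the in-layer hexagon, the
  touching triples of the layers `±1` and the second-shell triples of the layers `±1` (layer
  coordinates `(k, i, j)` with `|k|, |i|, |j| ≤ 1`; norms `a`, `√2·a`);
* `exists_pattern_of_norm_le` — conversely every non-zero stacking point of norm `≤ 3a/2` is one
  of the eighteen (integer distance form `3(2i+j+L)² + (3j+L)² + 8k² ≤ 27`,
  `exists_hcpTwoShellInt_of_form_le`);
* `hcp_twoShell_sites` — hence around EVERY point `p` of the stacking there is a linear isometry
  `A` with `p + a • A v` in the stacking for all eighteen pattern points `v` and every stacking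
  point within `3a/2` of `p` of this form (homogeneity);
* `good_of_sites_occupied_hcp` — a particle of an hcp sub-configuration all of whose eighteen
  sites are occupied is `1/20`-good (exact match), so (`stub_hcpShell`, registered sub-goal of the
  crux item) a BAD particle has a vacant two-shell site at distance `a` or `√2·a`.
-/

noncomputable section

namespace Summit.AtomisticToContinuum.Crystallization.Theorems.PhononSlackCertificatesNearFarGlueR

open Literature.MathematicalPhysics.StatisticalMechanics
open Literature.Geometry.DiscreteGeometry
open scoped BigOperators

/-! ## §1 The eighteen two-shell sites of the origin of the hcp stacking -/

/-- **Pattern → sites (integer bookkeeping).**  Every vector `t` of the integer model of the hcp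
two-shell pattern corresponds to layer coordinates `(k, i, j)`, `|k|, |i|, |j| ≤ 1`, through the
three linear relations expressing `a • A₁ (t/√18) = barlowPos a h alternatingHagg k i j` in
coordinates (`A₁` the close-packing frame, layer label `L(k) = k²` for `|k| ≤ 1`). [folklore] -/
theorem exists_site_of_mem_hcpTwoShellInt :
    ∀ t ∈ hcpInt ∪ hcpSecondShellInt,
      ∃ k ∈ Finset.Icc (-1 : ℤ) 1, ∃ i ∈ Finset.Icc (-1 : ℤ) 1, ∃ j ∈ Finset.Icc (-1 : ℤ) 1,
        t 0 + t 1 + t 2 = 6 * k ∧ -(t 0 - t 1) = 6 * i + 3 * j + 3 * k ^ 2 ∧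
          -(t 0 + t 1 - 2 * t 2) = 9 * j + 3 * k ^ 2 := by
  decide

/-- Members of `[-1, 1]` have square at most `1`. [folklore] -/
theorem sq_le_one_of_mem_Icc {k : ℤ} (hk : k ∈ Finset.Icc (-1 : ℤ) 1) : k ^ 2 ≤ 1 := by
  obtain ⟨h1, h2⟩ := Finset.mem_Icc.1 hk
  nlinarith

/-- The hcp layer labels of the layers `−1, 0, 1`: `L(k) = k²`. [folklore] -/
theorem haggLabel_alternating_of_sq_le_one {k : ℤ} (hk : k ^ 2 ≤ 1) :
    haggLabel alternatingHagg k = k ^ 2 := by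
  obtain ⟨h1, h2⟩ := abs_le_one_of_sq_le_one hk
  rw [haggLabel_alternating]
  interval_cases k <;> decide

/-- `√18 = 3·√2`. [folklore] -/
theorem sqrt_eighteen_nat : Real.sqrt ((18 : ℕ) : ℝ) = 3 * Real.sqrt 2 := by
  rw [Nat.cast_ofNat, show (18 : ℝ) = 3 ^ 2 * 2 by norm_num, Real.sqrt_mul (by norm_num) 2,
    Real.sqrt_sq (by norm_num)]

/-- The ideal layer spacing in Hales's normalisation: `h² = ⅔a²`, `h > 0`, `a > 0` give
`h = (a/2)·𝗁` with `𝗁 = layerSpacing = 2√(2/3)`. [folklore] -/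
theorem eq_half_mul_layerSpacing {a h : ℝ} (ha : 0 < a) (h0 : 0 < h)
    (hh : h ^ 2 = 2 / 3 * a ^ 2) : h = a / 2 * layerSpacing := by
  have hpos : 0 < a / 2 * layerSpacing := by
    have := layerSpacing_pos; positivity
  have hsq : (a / 2 * layerSpacing) ^ 2 = h ^ 2 := by
    rw [mul_pow, layerSpacing_sq, hh]; ring
  have := (sq_eq_sq₀ h0.le hpos.le).1 hsq.symm
  exact this

/-- **The frame identity.**  If the integer vector `t` and the layer coordinates `(k, i, j)`,
`|k| ≤ 1`, satisfy the three relations of `exists_site_of_mem_hcpTwoShellInt`, then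
`a • A₁ (t/√18) = barlowPos a h alternatingHagg k i j` for the ideal spacing (`A₁` the
close-packing frame of sign `1`). [folklore] -/
theorem smul_closePackingFrame_eq_barlowPos {a h : ℝ} (ha : 0 < a) (h0 : 0 < h)
    (hh : h ^ 2 = 2 / 3 * a ^ 2) {t : Fin 3 → ℤ} {k i j : ℤ} (hk : k ^ 2 ≤ 1)
    (hS : t 0 + t 1 + t 2 = 6 * k) (hx : -(t 0 - t 1) = 6 * i + 3 * j + 3 * k ^ 2)
    (hy : -(t 0 + t 1 - 2 * t 2) = 9 * j + 3 * k ^ 2) :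
    a • closePackingFrame 1 (Or.inl rfl) ((Real.sqrt ((18 : ℕ) : ℝ))⁻¹ • intVec t) =
      barlowPos a h alternatingHagg k i j := by
  have hL : (haggLabel alternatingHagg k : ℝ) = (k : ℝ) ^ 2 := by
    rw [haggLabel_alternating_of_sq_le_one hk]; push_cast; ring
  have hS' : (t 0 : ℝ) + t 1 + t 2 = 6 * k := by exact_mod_cast hS
  have hx' : -((t 0 : ℝ) - t 1) = 6 * i + 3 * j + 3 * (k : ℝ) ^ 2 := by exact_mod_cast hx
  have hy' : -((t 0 : ℝ) + t 1 - 2 * t 2) = 9 * j + 3 * (k : ℝ) ^ 2 := by exact_mod_cast hy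
  have hh' : h = a / 2 * layerSpacing := eq_half_mul_layerSpacing ha h0 hh
  have h2ne : Real.sqrt 2 ≠ 0 := by positivity
  have hinv : (Real.sqrt (18 : ℝ))⁻¹ * Real.sqrt 2 = 1 / 3 := by
    have := sqrt_eighteen_nat
    rw [Nat.cast_ofNat] at this
    rw [this]; field_simp
  ext l
  fin_cases l
  · simp [barlowPos, triangularVec₁, triangularVec₂, barlowOffset, layerNormal, hL]
    linear_combination (-(a / 2 * ((t 0 : ℝ) - t 1))) * hinv + (a / 6) * hx'
  · simp [barlowPos, triangularVec₁, triangularVec₂, barlowOffset, layerNormal, hL]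
    linear_combination (-(a * Real.sqrt 3 / 6 * ((t 0 : ℝ) + t 1 - 2 * t 2))) * hinv +
      (a * Real.sqrt 3 / 18) * hy'
  · simp [barlowPos, triangularVec₁, triangularVec₂, barlowOffset, layerNormal, hL, hh']
    linear_combination (a * layerSpacing * ((t 0 : ℝ) + t 1 + t 2) / 4) * hinv +
      (a * layerSpacing / 12) * hS'


/-! ## §2 The sites are stacking points; every close stacking point is a site -/

/-- **Pattern sites are stacking points**: for every point `v` of the hcp two-shell pattern,
`a • A₁ v` is a point of the ideal stacking `hcpStacking a h` (`A₁ = closePackingFrame 1`).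
[folklore] -/
theorem smul_frame_mem_hcpStacking {a h : ℝ} (ha : 0 < a) (h0 : 0 < h)
    (hh : h ^ 2 = 2 / 3 * a ^ 2) {v : EuclideanSpace ℝ (Fin 3)} (hv : v ∈ hcpTwoShellPattern) :
    a • closePackingFrame 1 (Or.inl rfl) v ∈ hcpStacking a h := by
  rw [hcpTwoShellPattern, scaledPattern, Finset.mem_image] at hv
  obtain ⟨t, ht, rfl⟩ := hv
  obtain ⟨k, hk, i, -, j, -, hS, hx, hy⟩ := exists_site_of_mem_hcpTwoShellInt t ht
  rw [smul_closePackingFrame_eq_barlowPos ha h0 hh (sq_le_one_of_mem_Icc hk) hS hx hy]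
  exact barlowPos_mem _ _ _

/-- The norm of a site vector: `a` on the first shell, `√2·a` on the second. [folklore] -/
theorem norm_smul_frame {a : ℝ} (ha : 0 < a) {v : EuclideanSpace ℝ (Fin 3)}
    (hv : v ∈ hcpTwoShellPattern) :
    ‖a • closePackingFrame 1 (Or.inl rfl) v‖ = a ∨
      ‖a • closePackingFrame 1 (Or.inl rfl) v‖ = Real.sqrt 2 * a := by
  rw [norm_smul, LinearIsometry.norm_map, Real.norm_of_nonneg ha.le]
  rcases norm_of_mem_hcpTwoShellPattern hv with h | h
  · left; rw [h, mul_one]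
  · right; rw [h, mul_comm]

/-- Site vectors are non-zero. [folklore] -/
theorem smul_frame_ne_zero {a : ℝ} (ha : 0 < a) {v : EuclideanSpace ℝ (Fin 3)}
    (hv : v ∈ hcpTwoShellPattern) : a • closePackingFrame 1 (Or.inl rfl) v ≠ 0 := by
  intro h0
  have hn : ‖a • closePackingFrame 1 (Or.inl rfl) v‖ = 0 := by rw [h0, norm_zero]
  rcases norm_smul_frame ha hv with h | h
  · rw [h] at hn; linarith
  · rw [h] at hn
    have : 0 < Real.sqrt 2 * a := by positivity
    linarith

/-- **The integer classification (sites → pattern).**  A non-zero layer coordinate triple whose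
distance form `3(2i+j+k²)² + (3j+k²)² + 8k²` (twelve times the squared norm over `a²`, once
`|k| ≤ 1`) is at most `27` lies in the layers `−1, 0, 1` and comes from a vector of the integer
model of the hcp two-shell pattern (it is one of eighteen triples; bounded case check). [folklore] -/
theorem exists_hcpTwoShellInt_of_form_le {k i j : ℤ} (hne : (k, i, j) ≠ (0, 0, 0))
    (hF : 3 * (2 * i + j + k ^ 2) ^ 2 + (3 * j + k ^ 2) ^ 2 + 8 * k ^ 2 ≤ 27) :
    k ^ 2 ≤ 1 ∧ ∃ t ∈ hcpInt ∪ hcpSecondShellInt,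
      t 0 + t 1 + t 2 = 6 * k ∧ -(t 0 - t 1) = 6 * i + 3 * j + 3 * k ^ 2 ∧
        -(t 0 + t 1 - 2 * t 2) = 9 * j + 3 * k ^ 2 := by
  have hk4 : k ^ 2 ≤ 4 := by nlinarith [sq_nonneg (2 * i + j + k ^ 2), sq_nonneg (3 * j + k ^ 2)]
  obtain ⟨hk1, hk2⟩ := abs_le_two_of_sq_le_four hk4
  have hj36 : (3 * j + k ^ 2) ^ 2 < 6 ^ 2 := by
    nlinarith [sq_nonneg (2 * i + j + k ^ 2), sq_nonneg k]
  obtain ⟨hj1, hj2⟩ := abs_lt_of_sq_lt_sq' hj36 (by norm_num)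
  have hi16 : (2 * i + j + k ^ 2) ^ 2 < 4 ^ 2 := by
    nlinarith [sq_nonneg (3 * j + k ^ 2), sq_nonneg k]
  obtain ⟨hi1, hi2⟩ := abs_lt_of_sq_lt_sq' hi16 (by norm_num)
  set K : ℤ := k ^ 2 with hK
  have hK0 : 0 ≤ K := by rw [hK]; exact sq_nonneg k
  have hj3 : -3 ≤ j := by omega
  have hj4 : j ≤ 1 := by omega
  have hi3 : -4 ≤ i := by omega
  have hi4 : i ≤ 3 := by omega
  rw [hK] at hF ⊢
  interval_cases k <;> interval_cases i <;> interval_cases j <;>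
    first | exact absurd rfl hne | decide | (norm_num at hF)

/-- **Every non-zero stacking point of norm `≤ 3a/2` has distance form at most `27`** (ideal
spacing, `a > 0`), in layer coordinates: it lies in the layers `−1, 0, 1` and comes from the
integer model of the two-shell pattern. [folklore] -/
theorem exists_hcpTwoShellInt_of_norm_le {a h : ℝ} (ha : 0 < a) (hh : h ^ 2 = 2 / 3 * a ^ 2)
    {k i j : ℤ} (hne : (k, i, j) ≠ (0, 0, 0))
    (hle : ‖barlowPos a h alternatingHagg k i j‖ ≤ 3 / 2 * a) :
    k ^ 2 ≤ 1 ∧ ∃ t ∈ hcpInt ∪ hcpSecondShellInt,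
      t 0 + t 1 + t 2 = 6 * k ∧ -(t 0 - t 1) = 6 * i + 3 * j + 3 * k ^ 2 ∧
        -(t 0 + t 1 - 2 * t 2) = 9 * j + 3 * k ^ 2 := by
  have h12 := twelve_mul_dist_barlowPos_sq hh alternatingHagg 0 0 0 k i j
  have h00 : barlowPos a h alternatingHagg 0 0 0 = 0 := by simp [barlowPos]
  rw [h00, dist_comm, dist_zero_right, haggLabel_zero] at h12
  set L : ℤ := haggLabel alternatingHagg k with hLdef
  set F : ℤ := 3 * (2 * (0 - i) + (0 - j) + (0 - L)) ^ 2 + (3 * (0 - j) + (0 - L)) ^ 2 +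
    8 * (0 - k) ^ 2 with hFdef
  have ha2 : 0 < a ^ 2 := by positivity
  have hn2 : ‖barlowPos a h alternatingHagg k i j‖ ^ 2 ≤ (3 / 2 * a) ^ 2 :=
    pow_le_pow_left₀ (norm_nonneg _) hle 2
  have hF27r : (F : ℝ) ≤ 27 := by
    by_contra hcon
    push Not at hcon
    nlinarith
  have hF27 : F ≤ 27 := by exact_mod_cast hF27r
  -- the layer is `−1, 0, 1`, so `L = k²`
  have hk4 : k ^ 2 < 2 ^ 2 := by
    rw [hFdef] at hF27
    nlinarith [sq_nonneg (2 * (0 - i) + (0 - j) + (0 - L)), sq_nonneg (3 * (0 - j) + (0 - L))]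
  obtain ⟨hk1, hk2⟩ := abs_lt_of_sq_lt_sq' hk4 (by norm_num)
  have hk : k ^ 2 ≤ 1 := by nlinarith
  have hL : L = k ^ 2 := haggLabel_alternating_of_sq_le_one hk
  refine exists_hcpTwoShellInt_of_form_le hne ?_
  rw [hFdef, hL] at hF27
  nlinarith

/-- **Every non-zero stacking point of norm `≤ 3a/2` is a pattern site** `a • A₁ v`,
`v ∈ hcpTwoShellPattern` (ideal spacing). [folklore] -/
theorem exists_pattern_of_norm_le {a h : ℝ} (ha : 0 < a) (h0 : 0 < h)
    (hh : h ^ 2 = 2 / 3 * a ^ 2) {q : EuclideanSpace ℝ (Fin 3)} (hq : q ∈ hcpStacking a h)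
    (hq0 : q ≠ 0) (hle : ‖q‖ ≤ 3 / 2 * a) :
    ∃ v ∈ hcpTwoShellPattern, q = a • closePackingFrame 1 (Or.inl rfl) v := by
  obtain ⟨k, i, j, rfl⟩ := hq
  have hne : (k, i, j) ≠ (0, 0, 0) := by
    intro heq
    simp only [Prod.mk.injEq] at heq
    obtain ⟨rfl, rfl, rfl⟩ := heq
    exact hq0 (by simp [barlowPos])
  obtain ⟨hk, t, ht, hS, hx, hy⟩ := exists_hcpTwoShellInt_of_norm_le ha hh hne hle
  refine ⟨(Real.sqrt ((18 : ℕ) : ℝ))⁻¹ • intVec t, ?_, ?_⟩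
  · rw [hcpTwoShellPattern, scaledPattern]
    exact Finset.mem_image_of_mem _ ht
  · exact (smul_closePackingFrame_eq_barlowPos ha h0 hh hk hS hx hy).symm

/-! ## §3 The two-shell of an arbitrary point (homogeneity) -/

/-- **The two-shell sites of any point of the hcp stacking.**  For every point `p` of the ideal
stacking there is a linear isometry `A` (the close-packing frame followed by the identity or the
half-turn of `hcpStacking_homogeneous`) such that all eighteen points `p + a • A v`,
`v ∈ hcpTwoShellPattern`, are stacking points other than `p` at distance `a` or `√2·a`, and every
stacking point other than `p` within `3a/2` of `p` is one of them. [folklore] -/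
theorem hcp_twoShell_sites {a h : ℝ} (ha : 0 < a) (h0 : 0 < h) (hh : h ^ 2 = 2 / 3 * a ^ 2)
    {p : EuclideanSpace ℝ (Fin 3)} (hp : p ∈ hcpStacking a h) :
    ∃ A : EuclideanSpace ℝ (Fin 3) →ₗᵢ[ℝ] EuclideanSpace ℝ (Fin 3),
      (∀ v ∈ hcpTwoShellPattern, p + a • A v ∈ hcpStacking a h ∧ a • A v ≠ 0 ∧
        (‖a • A v‖ = a ∨ ‖a • A v‖ = Real.sqrt 2 * a)) ∧
      (∀ w ∈ hcpStacking a h, w ≠ p → dist w p ≤ 3 / 2 * a →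
        ∃ v ∈ hcpTwoShellPattern, w = p + a • A v) := by
  obtain ⟨B, hB⟩ := hcpStacking_homogeneous a h hp
  refine ⟨B.toLinearIsometry.comp (closePackingFrame 1 (Or.inl rfl)), ?_, ?_⟩
  · intro v hv
    have e : a • (B.toLinearIsometry.comp (closePackingFrame 1 (Or.inl rfl))) v =
        B (a • closePackingFrame 1 (Or.inl rfl) v) := by
      rw [map_smul]; rfl
    refine ⟨?_, ?_, ?_⟩
    · rw [e]; exact (hB _).1 (smul_frame_mem_hcpStacking ha h0 hh hv)
    · rw [e]
      intro h0'
      exact smul_frame_ne_zero ha hv ((LinearIsometryEquiv.map_eq_zero_iff B).1 h0')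
    · rw [e, LinearIsometryEquiv.norm_map]; exact norm_smul_frame ha hv
  · intro w hw hwp hd
    set q : EuclideanSpace ℝ (Fin 3) := B.symm (w - p) with hq
    have hwq : w = p + B q := by rw [hq, LinearIsometryEquiv.apply_symm_apply, add_sub_cancel]
    have hq1 : q ∈ hcpStacking a h := by rw [hB, ← hwq]; exact hw
    have hq0 : q ≠ 0 := by
      intro h0'
      apply hwp
      rw [hwq, h0', map_zero, add_zero]
    have hqn : ‖q‖ ≤ 3 / 2 * a := by
      rw [hq, LinearIsometryEquiv.norm_map, ← dist_eq_norm]; exact hd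
    obtain ⟨v, hv, hv'⟩ := exists_pattern_of_norm_le ha h0 hh hq1 hq0 hqn
    refine ⟨v, hv, ?_⟩
    rw [hwq, hv', map_smul]; rfl

/-! ## §4 A fully surrounded hcp particle is exactly good -/

/-- **Goodness of a fully surrounded hcp particle.**  If the particles sit on the ideal stacking
`hcpStacking a h` (`a ∈ [47/50, 1]`, distinct), `A` is a two-shell frame of `x i` in the sense of
`hcp_twoShell_sites`, and all eighteen sites `x i + a • A v` are occupied, then `i` is `1/20`-good:
exact match at scale `a` with the isometry `A` and the hcp pattern; the two-way clause holds
because the stacking points within `3a/2` of `x i` are exactly the eighteen sites. [folklore] -/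
theorem good_of_sites_occupied_hcp {a h : ℝ} (h47 : 47 / 50 ≤ a) (h1 : a ≤ 1) {N : ℕ}
    {x : Fin N → EuclideanSpace ℝ (Fin 3)} (hx : Function.Injective x)
    (hL : ∀ j, x j ∈ hcpStacking a h) (i : Fin N)
    (A : EuclideanSpace ℝ (Fin 3) →ₗᵢ[ℝ] EuclideanSpace ℝ (Fin 3))
    (hA0 : ∀ v ∈ hcpTwoShellPattern, a • A v ≠ 0)
    (hA2 : ∀ w ∈ hcpStacking a h, w ≠ x i → dist w (x i) ≤ 3 / 2 * a →
      ∃ v ∈ hcpTwoShellPattern, w = x i + a • A v)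
    (hocc : ∀ v ∈ hcpTwoShellPattern, ∃ j, x j = x i + a • A v) :
    IsTwoShellGood (1 / 20) (47 / 50) 1 x i := by
  classical
  have ha : 0 < a := by linarith
  -- the assignment: the occupant of the site, if any
  let f : EuclideanSpace ℝ (Fin 3) → Fin N := fun w =>
    if h : ∃ j, x j = x i + a • A w then h.choose else i
  have hf : ∀ w : EuclideanSpace ℝ (Fin 3), ∀ j, x j = x i + a • A w →
      f w = j ∧ x (f w) = x i + a • A w := by
    intro w j hj
    have hex : ∃ j, x j = x i + a • A w := ⟨j, hj⟩
    have hfw : f w = hex.choose := dif_pos hex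
    have hspec : x hex.choose = x i + a • A w := hex.choose_spec
    refine ⟨?_, by rw [hfw]; exact hspec⟩
    rw [hfw]
    exact hx (hspec.trans hj.symm)
  refine ⟨a, h47, h1, A, hcpTwoShellPattern, f, Or.inr rfl, ?_, ?_, ?_⟩
  · -- every pattern point is matched exactly by a particle other than `i`
    intro v hv
    obtain ⟨j, hj⟩ := hocc v hv
    obtain ⟨hfj, hxf⟩ := hf v j hj
    refine ⟨?_, ?_⟩
    · intro hfi
      have h0 : a • A v = 0 := by
        have := hxf
        rw [hfi] at this
        exact (add_eq_left.mp this.symm)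
      exact hA0 v hv h0
    · rw [hxf, dist_self]
      positivity
  · -- injectivity on the pattern
    intro v hv v' hv' hvv'
    obtain ⟨j, hj⟩ := hocc v hv
    obtain ⟨j', hj'⟩ := hocc v' hv'
    have e1 := (hf v j hj).2
    have e2 := (hf v' j' hj').2
    have : x i + a • A v = x i + a • A v' := by rw [← e1, ← e2, hvv']
    have h2 := add_left_cancel this
    have h3 : A v = A v' := smul_right_injective (EuclideanSpace ℝ (Fin 3)) ha.ne' h2
    exact A.injective h3
  · -- two-way: every particle within `3a/2` is a site occupant
    intro j hji hd
    have hne : x j ≠ x i := fun h => hji (hx h)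
    obtain ⟨v, hv, hv'⟩ := hA2 (x j) (hL j) hne hd
    exact ⟨v, hv, (hf v j hv').1⟩

/-- **A bad hcp particle has a vacant two-shell site**, at distance `a` or `√2·a` (ideal
stacking, `a ∈ [47/50, 1]`, distinct particles). [folklore] -/
theorem exists_vacant_site_of_bad_hcp {a h : ℝ} (h47 : 47 / 50 ≤ a) (h1 : a ≤ 1) (h0 : 0 < h)
    (hh : h ^ 2 = 2 / 3 * a ^ 2) {N : ℕ} {x : Fin N → EuclideanSpace ℝ (Fin 3)}
    (hx : Function.Injective x) (hL : ∀ j, x j ∈ hcpStacking a h) (i : Fin N)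
    (hbad : ¬ IsTwoShellGood (1 / 20) (47 / 50) 1 x i) :
    ∃ w ∈ hcpStacking a h, w ∉ Set.range x ∧
      (dist w (x i) = a ∨ dist w (x i) = Real.sqrt 2 * a) := by
  have ha : 0 < a := by linarith
  obtain ⟨A, hA1, hA2⟩ := hcp_twoShell_sites ha h0 hh (hL i)
  by_contra hcon
  push Not at hcon
  refine hbad (good_of_sites_occupied_hcp h47 h1 hx hL i A (fun v hv => (hA1 v hv).2.1) hA2 ?_)
  intro v hv
  obtain ⟨hmem, -, hnorm⟩ := hA1 v hv
  by_contra hno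
  push Not at hno
  have hrange : x i + a • A v ∉ Set.range x := by
    rintro ⟨j, hj⟩
    exact hno j hj
  have hdist : dist (x i + a • A v) (x i) = ‖a • A v‖ := by
    rw [dist_comm, dist_self_add_right]
  rcases hnorm with hn | hn
  · exact (hcon _ hmem hrange).1 (by rw [hdist, hn])
  · exact (hcon _ hmem hrange).2 (by rw [hdist, hn])

/-- **Registered sub-goal `stub_hcpShell` of the crux item** (line `Sketch`, continuation lead
c2): a bad particle of a sub-configuration of the ideal hexagonal close packing has a vacant
two-shell site, at distance `a` or `√2·a` (`exists_vacant_site_of_bad_hcp`, quantified form).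
[folklore] -/
theorem stub_hcpShell :
    ∀ a h : ℝ, 47 / 50 ≤ a → a ≤ 1 → 0 < h → h ^ 2 = 2 / 3 * a ^ 2 →
    ∀ (N : ℕ) (x : Fin N → EuclideanSpace ℝ (Fin 3)), Function.Injective x →
      (∀ j : Fin N, x j ∈ hcpStacking a h) →
      ∀ i : Fin N, ¬ IsTwoShellGood (1 / 20) (47 / 50) 1 x i →
      ∃ w ∈ hcpStacking a h, w ∉ Set.range x ∧
        (dist w (x i) = a ∨ dist w (x i) = Real.sqrt 2 * a) :=
  fun _ _ h47 h1 h0 hh _ _ hx hL i hbad => exists_vacant_site_of_bad_hcp h47 h1 h0 hh hx hL i hbad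

end Summit.AtomisticToContinuum.Crystallization.Theorems.PhononSlackCertificatesNearFarGlueR

end
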